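import Mathlib
import Summits.ValiantsHypothesis.ValiantsHypothesis.Theorems.NewtonUnitEquationsNewtonTauWeakVdpDefs

/-!
# `NewtonTauWeak` (stmt-ValiantsHypothesis-5904), line `euler-wronskian-vdp`: structure of the flag tops

Stub `stub_vdpStructure` of the lead's skeleton (the STRUCTURE half of the ultrametric
Voorhoeve–van der Poorten argument): for a `ℂ`-linearly independent family `u_0,…,u_{k-1} ∈ ℂ[X,Y]`,
a generic weight `w` and the strict `w`-top `e` of `s = Σ_i u_i`, there is a flag index `j < k` with
`e + top W_j = top W_{j+1}`, where `W_j = flagW u j = W(u_0,…,u_{j-1})` are the flag Euler–Wronskians.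
The leading-term statement (`stub_leadingTermWronskian`, another file) enters as the hypothesis `hLT`.

Proof.
* `VdpStructure.eulerWronskian_eq_of_triangular`: unitriangular column operations do not change the
  Euler–Wronskian (`M_y = M_x · P` with `P` unipotent upper triangular, `det P = 1`).
* `VdpStructure.exists_reduced`: min-top representatives `ũ_i ∈ u_i + span(u_{i'} : i' < i)` (a coset of
  nonzero elements by linear independence, with tops in the finite set `⋃ supp u_i`) chosen with top of
  minimal `w`-degree have pairwise distinct tops `f_i`: a shared top could be cancelled inside the coset
  (`VdpStructure.wdeg_lt_of_isTop_sub`), contradicting minimality.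
* `VdpStructure.isTop_flag`: `W(ũ_{<n}) = W(u_{<n})`, so `hLT` gives `top W_n = Σ_{i<n} f_i`.
* `stub_vdpStructure`: if `e = f_i` take `j = i`; otherwise the family `(ũ_0,…,ũ_{k-2}, s)` has pairwise
  distinct tops, its Wronskian is `W_k` (column operations again, `s = u_{k-1} + Σ_{i<k-1} u_i`), and `hLT`
  gives `top W_k = top W_{k-1} + e`; take `j = k-1`.
[KPT arXiv:1205.1015 §2 (real analogue); folklore]
-/

-- the namespace mandated for this Theorems file repeats the component `ValiantsHypothesis`
set_option linter.dupNamespace false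

noncomputable section

namespace Summit.ValiantsHypothesis.ValiantsHypothesis.Theorems.NewtonUnitEquationsNewtonTauWeak

open scoped BigOperators Polynomial
open MvPolynomial
open Literature.Computability.AlgebraicComplexity (newtonVertexCount)
open Summit.ValiantsHypothesis.ValiantsHypothesis.Theorems.NewtonTauWeakVdp

namespace VdpStructure

/-! ## Column operations -/

/-- **Unitriangular column operations do not change the Euler–Wronskian**: if
`y_b = x_b + Σ_{b'} c_{b b'} x_{b'}` with `c_{b b'} = 0` whenever `b ≤ b'`, then `W(y) = W(x)`
(the Wronskian matrix of `y` is that of `x` times a unipotent upper-triangular matrix). [folklore] -/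
theorem eulerWronskian_eq_of_triangular {r : ℕ} (x y : Fin r → MvPolynomial (Fin 2) Slope)
    (c : Fin r → Fin r → Slope) (hc : ∀ b b', b ≤ b' → c b b' = 0)
    (hy : ∀ b, y b = x b + ∑ b', c b b' • x b') : eulerWronskian y = eulerWronskian x := by
  classical
  have hP : (Matrix.of fun a b : Fin r => euler^[(a : ℕ)] (y b)) =
      (Matrix.of fun a b : Fin r => euler^[(a : ℕ)] (x b)) *
        (1 + Matrix.of fun b' b : Fin r => C (c b b')) := by
    refine Matrix.ext fun a b => ?_
    rw [Matrix.mul_add, Matrix.mul_one, Matrix.add_apply, Matrix.mul_apply]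
    simp only [Matrix.of_apply]
    rw [hy, euler_iterate_add, euler_iterate_sum, add_right_inj]
    refine Finset.sum_congr rfl fun b' _ => ?_
    rw [euler_iterate_smul, smul_eq_C_mul, mul_comm]
  have htri : (1 + Matrix.of fun b' b : Fin r => C (c b b') :
      Matrix (Fin r) (Fin r) (MvPolynomial (Fin 2) Slope)).BlockTriangular id := by
    intro i j hij
    have hij' : j < i := hij
    rw [Matrix.add_apply, Matrix.one_apply_ne hij'.ne', Matrix.of_apply, hc j i hij'.le, C_0,
      add_zero]
  have hdet : (1 + Matrix.of fun b' b : Fin r => C (c b b') :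
      Matrix (Fin r) (Fin r) (MvPolynomial (Fin 2) Slope)).det = 1 := by
    rw [Matrix.det_of_upperTriangular htri]
    refine Finset.prod_eq_one fun i _ => ?_
    rw [Matrix.add_apply, Matrix.one_apply_eq, Matrix.of_apply, hc i i le_rfl, C_0, add_zero]
  unfold eulerWronskian
  rw [hP, Matrix.det_mul, hdet, mul_one]

/-- Unitriangular column operations over `ℂ` (before base change) do not change the Euler–Wronskian.
[folklore] -/
theorem eulerWronskian_baseChange_eq_of_triangular {r : ℕ} (x y : Fin r → MvPolynomial (Fin 2) ℂ)
    (d : Fin r → Fin r → ℂ) (hd : ∀ b b', b ≤ b' → d b b' = 0)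
    (hy : ∀ b, y b = x b + ∑ b', d b b' • x b') :
    eulerWronskian (fun b => baseChange (y b)) = eulerWronskian (fun b => baseChange (x b)) := by
  refine eulerWronskian_eq_of_triangular _ _ (fun b b' => Polynomial.C (d b b'))
    (fun b b' h => by rw [hd b b' h, map_zero]) fun b => ?_
  rw [hy, baseChange_add, baseChange_sum]
  simp_rw [baseChange_smul]

/-- Reindexing a sum over `Fin k` whose terms vanish from `n ≤ k` on as a sum over `Fin n`. [folklore] -/
theorem sum_eq_sum_castLE {M : Type*} [AddCommMonoid M] {n k : ℕ} (hn : n ≤ k) (g : Fin k → M)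
    (hg : ∀ i : Fin k, n ≤ (i : ℕ) → g i = 0) :
    ∑ i, g i = ∑ b : Fin n, g (Fin.castLE hn b) := by
  classical
  have h1 : ∑ b : Fin n, g (Fin.castLE hn b) = ∑ i ∈ Finset.univ.image (Fin.castLE hn), g i :=
    (Finset.sum_image fun a _ b _ h => Fin.castLE_injective hn h).symm
  rw [h1]
  refine (Finset.sum_subset (Finset.subset_univ _) fun i _ hi => hg i ?_).symm
  by_contra hlt
  exact hi (Finset.mem_image.mpr ⟨⟨i, not_le.mp hlt⟩, Finset.mem_univ _, Fin.ext rfl⟩)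

/-- `Σ_{b < n+1} f b = Σ_{b < n} f b + f n` along `Fin.castLE`. [folklore] -/
theorem sum_castLE_succ {M : Type*} [AddCommMonoid M] {k : ℕ} (f : Fin k → M) (n : ℕ)
    (h : n + 1 ≤ k) :
    ∑ b : Fin (n + 1), f (Fin.castLE h b) =
      ∑ b : Fin n, f (Fin.castLE (n.le_succ.trans h) b) + f ⟨n, h⟩ := by
  rw [Fin.sum_univ_castSucc]
  rfl

/-! ## Min-top representatives -/

section Reduced

variable {k : ℕ} {u : Fin k → MvPolynomial (Fin 2) ℂ} {w : Fin 2 → ℝ}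

/-- Elements of the coset `u_i + span(u_{i'} : i' < i)` are nonzero (linear independence). [folklore] -/
theorem ne_zero_of_sub_mem_span (hu : LinearIndependent ℂ u) (i : Fin k)
    {y : MvPolynomial (Fin 2) ℂ} (hy : y - u i ∈ Submodule.span ℂ (u '' Set.Iio i)) : y ≠ 0 := by
  rintro rfl
  rw [zero_sub, Submodule.neg_mem_iff] at hy
  exact hu.notMem_span_image (fun h => lt_irrefl i h) hy

/-- Elements of `span(u)` have support inside `⋃_i supp u_i`. [folklore] -/
theorem support_subset_of_mem_span {y : MvPolynomial (Fin 2) ℂ}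
    (hy : y ∈ Submodule.span ℂ (Set.range u)) :
    y.support ⊆ Finset.univ.biUnion fun i => (u i).support := by
  classical
  obtain ⟨c, rfl⟩ := (Submodule.mem_span_range_iff_exists_fun ℂ).mp hy
  intro g hg
  obtain ⟨i, -, hi⟩ := Finset.mem_biUnion.mp (support_sum hg)
  exact Finset.mem_biUnion.mpr ⟨i, Finset.mem_univ _, support_smul hi⟩

/-- The coset `u_i + span(u_{<i})` lies in `span(u)`. [folklore] -/
theorem mem_span_range_of_sub_mem_span (i : Fin k) {y : MvPolynomial (Fin 2) ℂ}
    (hy : y - u i ∈ Submodule.span ℂ (u '' Set.Iio i)) : y ∈ Submodule.span ℂ (Set.range u) := by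
  have h1 : y - u i ∈ Submodule.span ℂ (Set.range u) :=
    Submodule.span_mono (Set.image_subset_range u _) hy
  have h2 : u i ∈ Submodule.span ℂ (Set.range u) := Submodule.subset_span (Set.mem_range_self i)
  simpa using Submodule.add_mem _ h1 h2

/-- **Min-top representative**: the coset `u_i + span(u_{<i})` contains an element whose strict top
has minimal `w`-degree among all tops realised in the coset. [folklore] -/
theorem exists_minTop (hu : LinearIndependent ℂ u) (hw : IsGeneric w) (i : Fin k) :
    ∃ (y : MvPolynomial (Fin 2) ℂ) (g : Fin 2 →₀ ℕ), y - u i ∈ Submodule.span ℂ (u '' Set.Iio i) ∧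
      IsTop w y g ∧ ∀ y' g', y' - u i ∈ Submodule.span ℂ (u '' Set.Iio i) → IsTop w y' g' →
        wdeg w g ≤ wdeg w g' := by
  classical
  have hfin : {g : Fin 2 →₀ ℕ | ∃ y, y - u i ∈ Submodule.span ℂ (u '' Set.Iio i) ∧
      IsTop w y g}.Finite := by
    refine (Finset.univ.biUnion fun i => (u i).support).finite_toSet.subset ?_
    rintro g ⟨y, hy, hg⟩
    exact support_subset_of_mem_span (mem_span_range_of_sub_mem_span i hy) hg.mem
  have hu0 : u i - u i ∈ Submodule.span ℂ (u '' Set.Iio i) := by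
    rw [sub_self]
    exact Submodule.zero_mem _
  obtain ⟨g₀, hg₀⟩ := exists_isTop hw (ne_zero_of_sub_mem_span hu i hu0)
  obtain ⟨g, ⟨y, hy, hyg⟩, hmin⟩ := Set.exists_min_image _ (wdeg w) hfin ⟨g₀, u i, hu0, hg₀⟩
  exact ⟨y, g, hy, hyg, fun y' g' hy' hg' => hmin g' ⟨y', hy', hg'⟩⟩

/-- **Cancellation**: if `p` and `q` share the strict top `g`, every exponent of `p - (p_g/q_g)·q` has
`w`-degree `< wdeg g`. [folklore] -/
theorem wdeg_lt_of_isTop_sub {p q : MvPolynomial (Fin 2) ℂ} {g g' : Fin 2 →₀ ℕ} (hp : IsTop w p g)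
    (hq : IsTop w q g) (hg' : IsTop w (p - (coeff g p / coeff g q) • q) g') :
    wdeg w g' < wdeg w g := by
  have hmem := hg'.mem
  rw [mem_support_iff, coeff_sub, coeff_smul, smul_eq_mul] at hmem
  have hne : g' ≠ g := by
    rintro rfl
    exact hmem (by rw [div_mul_cancel₀ _ (mem_support_iff.mp hq.mem), sub_self])
  by_cases hpg : g' ∈ p.support
  · exact hp.lt hpg hne
  · refine hq.lt (mem_support_iff.mpr fun h0 => hmem ?_) hne
    rw [notMem_support_iff.mp hpg, h0, mul_zero, sub_zero]

/-- The top of a min-top representative of index `i` is not the top of any element of `span(u_{<i})`.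
[folklore] -/
theorem not_isTop_of_mem_span (hu : LinearIndependent ℂ u) (hw : IsGeneric w) (i : Fin k)
    {y : MvPolynomial (Fin 2) ℂ} {g : Fin 2 →₀ ℕ} (hy : y - u i ∈ Submodule.span ℂ (u '' Set.Iio i))
    (hyg : IsTop w y g)
    (hmin : ∀ y' g', y' - u i ∈ Submodule.span ℂ (u '' Set.Iio i) → IsTop w y' g' →
      wdeg w g ≤ wdeg w g')
    {q : MvPolynomial (Fin 2) ℂ} (hq : q ∈ Submodule.span ℂ (u '' Set.Iio i)) (hqg : IsTop w q g) :
    False := by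
  have hz : y - (coeff g y / coeff g q) • q - u i ∈ Submodule.span ℂ (u '' Set.Iio i) := by
    rw [sub_right_comm]
    exact Submodule.sub_mem _ hy (Submodule.smul_mem _ _ hq)
  obtain ⟨g', hg'⟩ := exists_isTop hw (ne_zero_of_sub_mem_span hu i hz)
  exact absurd (wdeg_lt_of_isTop_sub hyg hqg hg') (not_lt.mpr (hmin _ g' hz hg'))

/-- A coset element of index `i` lies in `span(u_{<i'})` for `i < i'`. [folklore] -/
theorem mem_span_of_lt {ũ : Fin k → MvPolynomial (Fin 2) ℂ}
    (hmem : ∀ i, ũ i - u i ∈ Submodule.span ℂ (u '' Set.Iio i)) {i i' : Fin k} (h : i < i') :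
    ũ i ∈ Submodule.span ℂ (u '' Set.Iio i') := by
  have h1 : ũ i - u i ∈ Submodule.span ℂ (u '' Set.Iio i') :=
    Submodule.span_mono (Set.image_mono (Set.Iio_subset_Iio h.le)) (hmem i)
  have h2 : u i ∈ Submodule.span ℂ (u '' Set.Iio i') := Submodule.subset_span ⟨i, h, rfl⟩
  simpa using Submodule.add_mem _ h1 h2

/-- **Reduced family**: representatives `ũ_i ∈ u_i + span(u_{<i})` with pairwise distinct strict tops.
[folklore] -/
theorem exists_reduced (hu : LinearIndependent ℂ u) (hw : IsGeneric w) :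
    ∃ (ũ : Fin k → MvPolynomial (Fin 2) ℂ) (f : Fin k → (Fin 2 →₀ ℕ)),
      (∀ i, ũ i - u i ∈ Submodule.span ℂ (u '' Set.Iio i)) ∧ (∀ i, IsTop w (ũ i) (f i)) ∧
        Function.Injective f := by
  choose ũ f hmem htop hmin using exists_minTop hu hw
  refine ⟨ũ, f, hmem, htop, fun i i' h => ?_⟩
  by_contra hne
  rcases lt_or_gt_of_ne hne with hlt | hlt
  · exact not_isTop_of_mem_span hu hw i' (hmem i') (htop i') (hmin i') (mem_span_of_lt hmem hlt)
      (h ▸ htop i)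
  · exact not_isTop_of_mem_span hu hw i (hmem i) (htop i) (hmin i) (mem_span_of_lt hmem hlt)
      (h ▸ htop i')

/-- Coefficients of an element of `span(u_{<i})`, as a function on `Fin k` vanishing from `i` on.
[folklore] -/
theorem exists_coeff_of_mem_span {i : Fin k} {y : MvPolynomial (Fin 2) ℂ}
    (hy : y ∈ Submodule.span ℂ (u '' Set.Iio i)) :
    ∃ d : Fin k → ℂ, (∀ i', i ≤ i' → d i' = 0) ∧ y = ∑ i', d i' • u i' := by
  obtain ⟨l, hl, rfl⟩ := (Finsupp.mem_span_image_iff_linearCombination ℂ).mp hy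
  refine ⟨l, fun i' hi' => (Finsupp.mem_supported' ℂ l).mp hl i' fun h' => ?_, ?_⟩
  · exact (not_lt.mpr hi') h'
  · rw [Finsupp.linearCombination_apply]
    exact Finsupp.sum_fintype l (fun i' a => a • u i') fun _ => zero_smul _ _

end Reduced

/-! ## Tops of the flag Wronskians -/

/-- **Tops of the flag.**  For a reduced family `ũ_i = u_i + Σ_{i'} l_{i i'} u_{i'}` (`l` strictly lower
triangular) with pairwise distinct tops `f_i`, the leading-term statement gives
`top W(u_0,…,u_{n-1}) = Σ_{i<n} f_i` for every `n ≤ k`. [folklore] -/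
theorem isTop_flag
    (hLT : ∀ (r : ℕ) (v : Fin r → MvPolynomial (Fin 2) ℂ) (w : Fin 2 → ℝ), IsGeneric w →
      ∀ (e : Fin r → (Fin 2 →₀ ℕ)), (∀ b, IsTop w (v b) (e b)) → Function.Injective e →
        IsTop w (eulerWronskian fun b => baseChange (v b)) (∑ b, e b))
    {k : ℕ} {u ũ : Fin k → MvPolynomial (Fin 2) ℂ} {w : Fin 2 → ℝ} (hw : IsGeneric w)
    {l : Fin k → Fin k → ℂ} (hl : ∀ i i', i ≤ i' → l i i' = 0)
    (hũ : ∀ i, ũ i = u i + ∑ i', l i i' • u i') {f : Fin k → (Fin 2 →₀ ℕ)}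
    (htop : ∀ i, IsTop w (ũ i) (f i)) (hinj : Function.Injective f) (n : ℕ) (hn : n ≤ k) :
    IsTop w (eulerWronskian fun b : Fin n => baseChange (u (Fin.castLE hn b)))
      (∑ b : Fin n, f (Fin.castLE hn b)) := by
  have hW := eulerWronskian_baseChange_eq_of_triangular (fun b => u (Fin.castLE hn b))
    (fun b => ũ (Fin.castLE hn b)) (fun b b' => l (Fin.castLE hn b) (Fin.castLE hn b'))
    (fun b b' h => hl _ _ h) fun b => ?_
  · rw [← hW]
    exact hLT n _ w hw _ (fun b => htop _) (hinj.comp (Fin.castLE_injective hn))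
  · rw [hũ]
    congr 1
    refine sum_eq_sum_castLE hn _ fun i' hi' => ?_
    rw [hl _ _ (Fin.le_def.mpr (b.isLt.le.trans hi')), zero_smul]

end VdpStructure

/-- **Structure of the flag tops** (stub `stub_vdpStructure` of the line `euler-wronskian-vdp`).
For a `ℂ`-linearly independent family `u_0,…,u_{k-1}`, a generic weight `w` and the strict `w`-top `e`
of `Σ_i u_i`, there is `j < k` with `e + top (flagW u j) = top (flagW u (j+1))`, given the leading-term
statement `hLT` for Euler–Wronskians of families with pairwise distinct tops.  Proof: min-top
representatives `ũ_i ∈ u_i + span(u_{<i})` have pairwise distinct tops `f_i`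
(`VdpStructure.exists_reduced`); unitriangular column operations give `W(ũ_{<n}) = W(u_{<n})`, so
`top W_n = Σ_{i<n} f_i` (`VdpStructure.isTop_flag`); if `e = f_i` take `j = i`, otherwise apply `hLT`
to `(ũ_0,…,ũ_{k-2}, Σ_i u_i)`, whose Wronskian is `W_k`, and take `j = k-1`.
[KPT arXiv:1205.1015 §2 (real analogue); folklore] -/
theorem stub_vdpStructure
    (hLT : ∀ (r : ℕ) (v : Fin r → MvPolynomial (Fin 2) ℂ) (w : Fin 2 → ℝ), IsGeneric w →
      ∀ (e : Fin r → (Fin 2 →₀ ℕ)), (∀ b, IsTop w (v b) (e b)) → Function.Injective e →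
        IsTop w (eulerWronskian fun b => baseChange (v b)) (∑ b, e b)) :
    ∀ (k : ℕ) (u : Fin k → MvPolynomial (Fin 2) ℂ), LinearIndependent ℂ u →
      ∀ (w : Fin 2 → ℝ), IsGeneric w → ∀ (e : Fin 2 →₀ ℕ), IsTop w (∑ i, u i) e →
        ∃ (j : Fin k) (a b : Fin 2 →₀ ℕ),
          IsTop w (flagW u (Fin.castSucc j)) a ∧ IsTop w (flagW u j.succ) b ∧ e + a = b := by
  intro k u hu w hw e he
  classical
  obtain ⟨ũ, f, hmem, htop, hinj⟩ := VdpStructure.exists_reduced hu hw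
  choose l hl hũ using fun i => VdpStructure.exists_coeff_of_mem_span (hmem i)
  have hũ' : ∀ i, ũ i = u i + ∑ i', l i i' • u i' := fun i => sub_eq_iff_eq_add'.mp (hũ i)
  have hflag := VdpStructure.isTop_flag hLT hw hl hũ' htop hinj
  by_cases hcase : ∃ i, f i = e
  · obtain ⟨i, hi⟩ := hcase
    refine ⟨i, _, _, hflag i (le_of_lt i.isLt), hflag ((i : ℕ) + 1) i.isLt, ?_⟩
    rw [VdpStructure.sum_castLE_succ, add_comm, ← hi]
  · push Not at hcase
    obtain ⟨k', rfl⟩ : ∃ k', k = k' + 1 :=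
      Nat.exists_eq_succ_of_ne_zero (by rintro rfl; exact he.ne_zero (by simp))
    obtain ⟨x, hx⟩ : ∃ x : Fin (k' + 1) → MvPolynomial (Fin 2) ℂ,
        x = Function.update ũ (Fin.last k') (∑ i, u i) := ⟨_, rfl⟩
    obtain ⟨ex, hex⟩ : ∃ ex : Fin (k' + 1) → (Fin 2 →₀ ℕ),
        ex = Function.update f (Fin.last k') e := ⟨_, rfl⟩
    have hxtop : ∀ b, IsTop w (x b) (ex b) := by
      intro b
      rcases eq_or_ne b (Fin.last k') with rfl | hb
      · rw [hx, hex, Function.update_self, Function.update_self]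
        exact he
      · rw [hx, hex, Function.update_of_ne hb, Function.update_of_ne hb]
        exact htop b
    have hexinj : Function.Injective ex := by
      intro a b hab
      rw [hex, Function.update_apply, Function.update_apply] at hab
      split_ifs at hab with h₁ h₂ h₃
      · exact h₁.trans h₂.symm
      · exact absurd hab.symm (hcase b)
      · exact absurd hab (hcase a)
      · exact hinj hab
    have hW := hLT (k' + 1) x w hw ex hxtop hexinj
    have hsum : ∑ b, ex b = ∑ b : Fin k', f (Fin.castLE (Nat.le_succ k') b) + e := by
      rw [Fin.sum_univ_castSucc, hex, Function.update_self]
      congr 1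
      exact Finset.sum_congr rfl fun b _ => Function.update_of_ne (Fin.castSucc_lt_last b).ne _ _
    have hWx : eulerWronskian (fun b => baseChange (x b)) =
        eulerWronskian (fun b => baseChange (u b)) := by
      refine VdpStructure.eulerWronskian_baseChange_eq_of_triangular u x
        (fun b b' => if b = Fin.last k' then (if b' < b then 1 else 0) else l b b') ?_ ?_
      · intro b b' hbb'
        split_ifs with h₁ h₂
        · exact absurd hbb' (not_le.mpr h₂)
        · rfl
        · exact hl b b' hbb'
      · intro b
        rcases eq_or_ne b (Fin.last k') with rfl | hb
        · rw [hx, Function.update_self]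
          simp only [if_true]
          rw [Fin.sum_univ_castSucc, Fin.sum_univ_castSucc]
          simp only [Fin.castSucc_lt_last, if_true, one_smul, lt_self_iff_false, if_false,
            zero_smul, add_zero]
          exact add_comm _ _
        · rw [hx, Function.update_of_ne hb]
          simp only [hb, if_false]
          exact hũ' b
    have hlast : flagW u (Fin.last (k' + 1)) = eulerWronskian (fun b => baseChange (u b)) := rfl
    refine ⟨Fin.last k', _, _, hflag k' (Nat.le_succ k'), ?_, add_comm e _⟩
    rw [Fin.succ_last, hlast, ← hWx, ← hsum]
    exact hW

end Summit.ValiantsHypothesis.ValiantsHypothesis.Theorems.NewtonUnitEquationsNewtonTauWeak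

end
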